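import Summits.HodgeConjecture.HodgeConjecture.Theorems.HodgeLocusCensusPlaneRank
import HarnessLib

/-!
# HodgeLocusCensusLinePairRank — PROVED: rank [p_{i+j}([Π₁] ± [Π₂])] = 8 for two planes of the Fermat quartic fourfold meeting in a LINE (cell pub-hlocus, LEAD gen 4, (T27))
HONEST FRAMING: certified instances and evidence bearing on the general Hodge conjecture; no claim.

Two census rows of `HodgeLocusCensusSchema` (R7; two- and three-engine evidence) are PROVED as kernel theorems: `explainedSmooth_4_4_1_quadric`
(δ = [Π(0,1,1)] + [Π(0,1,3)], the degenerate quadric surface {x₀ = ζx₁, x₂ = ζ³x₃, x₄² = −ix₅²}; rank 8 = codim of the CI(1,1,2) locus) and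
`openInstance_4_4_1_difference` (δ = [Π(0,1,1)] − [Π(0,1,3)]; rank 8, first-order excess 3 over the codim-11 reduced locus — only the RANK is typed and
only the rank is proved here; the component question of that row is untouched). The planes Π₁ = V(x₀−ζx₁, x₂−ζ³x₃, x₄−ζ³x₅), Π₂ = V(x₀−ζx₁, x₂−ζ³x₃,
x₄−ζ⁷x₅) share the line {x₄ = x₅ = 0}. MECHANISM: the characters (1,3,3), (1,3,7) differ by 4 in the last slot, so for ζ⁴ = −1 the entry collapses to
ζ^e(1 + s(−1)^{i₄+j₄+1}) (`entry_eq_parity`): 2ζ^e on 'all pair sums of i+j equal 2 ∧ i₄+j₄ odd' (s = +1) resp. '… ∧ i₄+j₄ even' (s = −1), else 0.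
The six pair-sum-type blocks of `HodgeLocusCensusPlaneRank` split by the parity of i₄; exactly 8 (type, parity) modes carry a row and a complementary
column (1+1+1+1+2+2), so M_δ = U·V through K⁸ (rank ≤ 8) and the 8 × 8 minor with one (row, column) per mode is DIAGONAL with entries 2ζ^e ≠ 0
(rank ≥ 8). Numerics of record: engines A (exact), B, R: 8 and 8 (COMPONENTS.md rows 2–3).
-/

namespace Summit.HodgeConjecture.HodgeConjecture.HodgeLocus.Census.LinePair
open TwistCells PlaneRank

/-- closed form of an entry of M_δ, δ = [Π₁] + s[Π₂], for an arbitrary ζ. -/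
theorem entry_eq {K : Type*} [Field K] (ζ : K) (s : ℚ) (i : Fin 6 → ℕ) (hi : i ∈ indexSet 4 4 (4 / 2 * 4 - 4 - 2))
    (j : Fin 6 → ℕ) (hj : j ∈ indexSet 4 4 4) :
    ivhsMatrix 4 4 ζ [(1, plane44 0 1 1), (s, plane44 0 1 3)] ⟨i, hi⟩ ⟨j, hj⟩ =
      if i 0 + j 0 + (i 1 + j 1) = 2 ∧ i 2 + j 2 + (i 3 + j 3) = 2 ∧ i 4 + j 4 + (i 5 + j 5) = 2 then
        ζ ^ ((i 0 + j 0 + 1) * (1 + 2 * 0) + (i 2 + j 2 + 1) * (1 + 2 * 1) + (i 4 + j 4 + 1) * (1 + 2 * 1)) +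
          (s : K) * ζ ^ ((i 0 + j 0 + 1) * (1 + 2 * 0) + (i 2 + j 2 + 1) * (1 + 2 * 1) + (i 4 + j 4 + 1) * (1 + 2 * 3)) else 0 := by
  unfold ivhsMatrix periodComb
  simp only [List.map, List.sum_cons, List.sum_nil, Rat.cast_one, one_mul, add_zero, period_plane44]
  split_ifs <;> simp

/-- COLLAPSE for a primitive 8th root: the entry is 2ζ^e when all pair sums are 2 and i₄+j₄ has parity t (t = 1 for s = +1, t = 0 for s = −1), else 0. -/
theorem entry_eq_parity {K : Type*} [Field K] (ζ : K) (h4 : ζ ^ 4 = -1) (s : ℚ) (t : ℕ) (hst : s = 1 ∧ t = 1 ∨ s = -1 ∧ t = 0)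
    (i : Fin 6 → ℕ) (hi : i ∈ indexSet 4 4 (4 / 2 * 4 - 4 - 2)) (j : Fin 6 → ℕ) (hj : j ∈ indexSet 4 4 4) :
    ivhsMatrix 4 4 ζ [(1, plane44 0 1 1), (s, plane44 0 1 3)] ⟨i, hi⟩ ⟨j, hj⟩ =
      if (i 0 + j 0 + (i 1 + j 1) = 2 ∧ i 2 + j 2 + (i 3 + j 3) = 2 ∧ i 4 + j 4 + (i 5 + j 5) = 2) ∧ (i 4 + j 4) % 2 = t then
        2 * ζ ^ ((i 0 + j 0 + 1) * (1 + 2 * 0) + (i 2 + j 2 + 1) * (1 + 2 * 1) + (i 4 + j 4 + 1) * (1 + 2 * 1)) else 0 := by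
  rw [entry_eq]
  by_cases hc : i 0 + j 0 + (i 1 + j 1) = 2 ∧ i 2 + j 2 + (i 3 + j 3) = 2 ∧ i 4 + j 4 + (i 5 + j 5) = 2
  · rw [if_pos hc]
    have e13 : (i 0 + j 0 + 1) * (1 + 2 * 0) + (i 2 + j 2 + 1) * (1 + 2 * 1) + (i 4 + j 4 + 1) * (1 + 2 * 3) =
        (i 0 + j 0 + 1) * (1 + 2 * 0) + (i 2 + j 2 + 1) * (1 + 2 * 1) + (i 4 + j 4 + 1) * (1 + 2 * 1) + 4 * (i 4 + j 4 + 1) := by ring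
    rw [e13, pow_add _ _ (4 * (i 4 + j 4 + 1)), pow_mul, h4]
    rcases hst with ⟨rfl, rfl⟩ | ⟨rfl, rfl⟩
    · rcases Nat.even_or_odd (i 4 + j 4 + 1) with hB | hB
      · rw [hB.neg_one_pow, if_pos ⟨hc, by rcases hB with ⟨b, hb⟩; omega⟩]
        simp; ring
      · rw [hB.neg_one_pow, if_neg (fun h => by rcases hB with ⟨b, hb⟩; omega)]
        simp
    · rcases Nat.even_or_odd (i 4 + j 4 + 1) with hB | hB
      · rw [hB.neg_one_pow, if_neg (fun h => by rcases hB with ⟨b, hb⟩; omega)]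
        simp
      · rw [hB.neg_one_pow, if_pos ⟨hc, by rcases hB with ⟨b, hb⟩; omega⟩]
        simp; ring
  · rw [if_neg hc, if_neg (fun h => hc h.1)]

/-- the same closed form for arbitrary row/column index terms (used on the witness minors). -/
theorem entry_eq_parity' {K : Type*} [Field K] (ζ : K) (h4 : ζ ^ 4 = -1) (s : ℚ) (t : ℕ) (hst : s = 1 ∧ t = 1 ∨ s = -1 ∧ t = 0)
    (i : indexSet 4 4 (4 / 2 * 4 - 4 - 2)) (j : indexSet 4 4 4) :
    ivhsMatrix 4 4 ζ [(1, plane44 0 1 1), (s, plane44 0 1 3)] i j =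
      if (i.1 0 + j.1 0 + (i.1 1 + j.1 1) = 2 ∧ i.1 2 + j.1 2 + (i.1 3 + j.1 3) = 2 ∧ i.1 4 + j.1 4 + (i.1 5 + j.1 5) = 2) ∧
          (i.1 4 + j.1 4) % 2 = t then
        2 * ζ ^ ((i.1 0 + j.1 0 + 1) * (1 + 2 * 0) + (i.1 2 + j.1 2 + 1) * (1 + 2 * 1) + (i.1 4 + j.1 4 + 1) * (1 + 2 * 1)) else 0 :=
  entry_eq_parity ζ h4 s t hst i.1 i.2 j.1 j.2

/-- the 8 (type, parity-of-i₄) MODES: type index into `PlaneRank.sig*` … -/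
def modeK : Fin 8 → Fin 6 := ![0, 1, 2, 3, 4, 4, 5, 5]
/-- … and parity of i₄ (on the type (0,0,2) it is t: the columns there have j₄ = 0). -/
def modeP (t : ℕ) : Fin 8 → ℕ := ![0, 0, t, 0, 0, 1, 0, 1]

/-- the modes are distinct as (type, parity), for t = 0, 1. -/
theorem mode_inj : ∀ t < 2, ∀ m m' : Fin 8, modeK m = modeK m' → modeP t m = modeP t m' → m = m' := by decide

/-- every row of I₂ belongs to a mode, except the rows of type (0,0,2) with i₄ of the wrong parity (whose entries all vanish). -/
theorem row_modes : ∀ t < 2, ∀ i ∈ indexSet 4 4 (4 / 2 * 4 - 4 - 2),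
    (∃ m : Fin 8, i 0 + i 1 = sig0 (modeK m) ∧ i 2 + i 3 = sig1 (modeK m) ∧ i 4 + i 5 = sig2 (modeK m) ∧ i 4 % 2 = modeP t m) ∨
    (i 4 + i 5 = 2 ∧ i 4 % 2 ≠ t) := by
  decide

/-- left factor U (rows × 8): 2ζ^{i₀ + 3i₂ + 3i₄} on the rows of the mode. -/
noncomputable def factorU {K : Type*} [Field K] (ζ : K) (t : ℕ) : Matrix (indexSet 4 4 (4 / 2 * 4 - 4 - 2)) (Fin 8) K :=
  fun i m => if i.1 0 + i.1 1 = sig0 (modeK m) ∧ i.1 2 + i.1 3 = sig1 (modeK m) ∧ i.1 4 + i.1 5 = sig2 (modeK m) ∧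
      i.1 4 % 2 = modeP t m then 2 * ζ ^ (i.1 0 + 3 * i.1 2 + 3 * i.1 4) else 0

/-- right factor V (8 × columns): ζ^{(j₀+1) + 3(j₂+1) + 3(j₄+1)} on the columns of complementary type whose j₄-parity complements the mode's to t. -/
noncomputable def factorV {K : Type*} [Field K] (ζ : K) (t : ℕ) : Matrix (Fin 8) (indexSet 4 4 4) K :=
  fun m j => if (sig0 (modeK m) + (j.1 0 + j.1 1) = 2 ∧ sig1 (modeK m) + (j.1 2 + j.1 3) = 2 ∧ sig2 (modeK m) + (j.1 4 + j.1 5) = 2) ∧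
      (j.1 4 + modeP t m) % 2 = t then ζ ^ ((j.1 0 + 1) + 3 * (j.1 2 + 1) + 3 * (j.1 4 + 1)) else 0

/-- STRUCTURE THEOREM (primitive ζ): M_{[Π₁] + s[Π₂]} = U · V through K⁸. -/
theorem ivhsMatrix_linePair_eq_mul {K : Type*} [Field K] (ζ : K) (h4 : ζ ^ 4 = -1) (s : ℚ) (t : ℕ)
    (hst : s = 1 ∧ t = 1 ∨ s = -1 ∧ t = 0) :
    ivhsMatrix 4 4 ζ [(1, plane44 0 1 1), (s, plane44 0 1 3)] = factorU ζ t * factorV ζ t := by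
  have ht : t < 2 := by rcases hst with ⟨-, rfl⟩ | ⟨-, rfl⟩ <;> norm_num
  ext ⟨i, hi⟩ ⟨j, hj⟩
  rw [entry_eq_parity ζ h4 s t hst, Matrix.mul_apply]
  rcases row_modes t ht i hi with ⟨m₀, h0, h1, h2, p4⟩ | hdead
  · rw [Finset.sum_eq_single m₀]
    · unfold factorU factorV
      simp only
      rw [if_pos (show i 0 + i 1 = sig0 (modeK m₀) ∧ i 2 + i 3 = sig1 (modeK m₀) ∧ i 4 + i 5 = sig2 (modeK m₀) ∧
          i 4 % 2 = modeP t m₀ from ⟨h0, h1, h2, p4⟩)]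
      by_cases hc : (sig0 (modeK m₀) + (j 0 + j 1) = 2 ∧ sig1 (modeK m₀) + (j 2 + j 3) = 2 ∧ sig2 (modeK m₀) + (j 4 + j 5) = 2) ∧
          (j 4 + modeP t m₀) % 2 = t
      · obtain ⟨⟨c0, c1, c2⟩, q4⟩ := hc
        rw [if_pos (show (sig0 (modeK m₀) + (j 0 + j 1) = 2 ∧ sig1 (modeK m₀) + (j 2 + j 3) = 2 ∧ sig2 (modeK m₀) + (j 4 + j 5) = 2) ∧
            (j 4 + modeP t m₀) % 2 = t from ⟨⟨c0, c1, c2⟩, q4⟩),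
          if_pos (show (i 0 + j 0 + (i 1 + j 1) = 2 ∧ i 2 + j 2 + (i 3 + j 3) = 2 ∧ i 4 + j 4 + (i 5 + j 5) = 2) ∧
            (i 4 + j 4) % 2 = t from ⟨⟨by omega, by omega, by omega⟩, by omega⟩)]
        ring
      · rw [if_neg hc, if_neg (fun h => hc ⟨⟨by omega, by omega, by omega⟩, by omega⟩)]
        simp
    · intro m _ hm
      unfold factorU
      rw [if_neg, zero_mul]
      intro h
      exact hm (mode_inj t ht m m₀ (sig_inj _ _ (h.1.symm.trans h0) (h.2.1.symm.trans h1) (h.2.2.1.symm.trans h2))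
        (h.2.2.2.symm.trans p4))
    · intro h
      exact absurd (Finset.mem_univ m₀) h
  · rw [if_neg (fun h => by omega), Finset.sum_eq_zero]
    intro m _
    unfold factorU
    rw [if_neg, zero_mul]
    rintro ⟨-, -, h2, p4⟩
    interval_cases t <;> fin_cases m <;> simp [modeK, modeP, sig2] at h2 p4 <;> omega

/-- UPPER BOUND: rank ≤ 8 for a primitive 8th root. -/
theorem rank_le_eight {K : Type*} [Field K] (ζ : K) (h4 : ζ ^ 4 = -1) (s : ℚ) (t : ℕ) (hst : s = 1 ∧ t = 1 ∨ s = -1 ∧ t = 0) :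
    (ivhsMatrix 4 4 ζ [(1, plane44 0 1 1), (s, plane44 0 1 3)]).rank ≤ 8 := by
  rw [ivhsMatrix_linePair_eq_mul ζ h4 s t hst]
  exact (Matrix.rank_mul_le_left _ _).trans (by simpa using Matrix.rank_le_card_width (factorU ζ t))

/-- one witness row per mode, s = +1 … -/
def rowPickPlus : Fin 8 → indexSet 4 4 (4 / 2 * 4 - 4 - 2) :=
  ![⟨![2, 0, 0, 0, 0, 0], by decide⟩, ⟨![0, 0, 1, 1, 0, 0], by decide⟩, ⟨![0, 0, 0, 0, 1, 1], by decide⟩, ⟨![1, 0, 1, 0, 0, 0], by decide⟩,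
    ⟨![1, 0, 0, 0, 0, 1], by decide⟩, ⟨![1, 0, 0, 0, 1, 0], by decide⟩, ⟨![0, 0, 1, 0, 0, 1], by decide⟩, ⟨![0, 0, 1, 0, 1, 0], by decide⟩]

/-- … and columns, s = +1 (complementary type, j₄ of parity 1 − p). -/
def colPickPlus : Fin 8 → indexSet 4 4 4 :=
  ![⟨![0, 0, 1, 1, 1, 1], by decide⟩, ⟨![1, 1, 0, 0, 1, 1], by decide⟩, ⟨![1, 1, 1, 1, 0, 0], by decide⟩, ⟨![1, 0, 1, 0, 1, 1], by decide⟩,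
    ⟨![1, 0, 1, 1, 1, 0], by decide⟩, ⟨![1, 0, 1, 1, 0, 1], by decide⟩, ⟨![1, 1, 1, 0, 1, 0], by decide⟩, ⟨![1, 1, 1, 0, 0, 1], by decide⟩]

/-- witness rows, s = −1 … -/
def rowPickMinus : Fin 8 → indexSet 4 4 (4 / 2 * 4 - 4 - 2) :=
  ![⟨![2, 0, 0, 0, 0, 0], by decide⟩, ⟨![0, 0, 1, 1, 0, 0], by decide⟩, ⟨![0, 0, 0, 0, 2, 0], by decide⟩, ⟨![1, 0, 1, 0, 0, 0], by decide⟩,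
    ⟨![1, 0, 0, 0, 0, 1], by decide⟩, ⟨![1, 0, 0, 0, 1, 0], by decide⟩, ⟨![0, 0, 1, 0, 0, 1], by decide⟩, ⟨![0, 0, 1, 0, 1, 0], by decide⟩]

/-- … and columns, s = −1 (complementary type, j₄ of parity p). -/
def colPickMinus : Fin 8 → indexSet 4 4 4 :=
  ![⟨![0, 0, 1, 1, 2, 0], by decide⟩, ⟨![1, 1, 0, 0, 0, 2], by decide⟩, ⟨![1, 1, 1, 1, 0, 0], by decide⟩, ⟨![1, 0, 1, 0, 0, 2], by decide⟩,
    ⟨![1, 0, 1, 1, 0, 1], by decide⟩, ⟨![1, 0, 1, 1, 1, 0], by decide⟩, ⟨![1, 1, 1, 0, 0, 1], by decide⟩, ⟨![1, 1, 1, 0, 1, 0], by decide⟩]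

/-- the + witness minor is diagonal … -/
theorem minorPlus_offdiag {K : Type*} [Field K] (ζ : K) (h4 : ζ ^ 4 = -1) (a b : Fin 8) (hab : a ≠ b) :
    ivhsMatrix 4 4 ζ [(1, plane44 0 1 1), (1, plane44 0 1 3)] (rowPickPlus a) (colPickPlus b) = 0 := by
  rw [entry_eq_parity' ζ h4 1 1 (Or.inl ⟨rfl, rfl⟩)]
  fin_cases a <;> fin_cases b <;> simp_all [rowPickPlus, colPickPlus]

/-- … with entries 2ζ^e ≠ 0 in characteristic 0. -/
theorem minorPlus_diag {K : Type*} [Field K] [CharZero K] (ζ : K) (h4 : ζ ^ 4 = -1) (hz : ζ ≠ 0) (a : Fin 8) :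
    ivhsMatrix 4 4 ζ [(1, plane44 0 1 1), (1, plane44 0 1 3)] (rowPickPlus a) (colPickPlus a) ≠ 0 := by
  rw [entry_eq_parity' ζ h4 1 1 (Or.inl ⟨rfl, rfl⟩)]
  fin_cases a <;> simp [rowPickPlus, colPickPlus, hz]

/-- the − witness minor is diagonal … -/
theorem minorMinus_offdiag {K : Type*} [Field K] (ζ : K) (h4 : ζ ^ 4 = -1) (a b : Fin 8) (hab : a ≠ b) :
    ivhsMatrix 4 4 ζ [(1, plane44 0 1 1), (-1, plane44 0 1 3)] (rowPickMinus a) (colPickMinus b) = 0 := by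
  rw [entry_eq_parity' ζ h4 (-1) 0 (Or.inr ⟨rfl, rfl⟩)]
  fin_cases a <;> fin_cases b <;> simp_all [rowPickMinus, colPickMinus]

/-- … with entries 2ζ^e ≠ 0 in characteristic 0. -/
theorem minorMinus_diag {K : Type*} [Field K] [CharZero K] (ζ : K) (h4 : ζ ^ 4 = -1) (hz : ζ ≠ 0) (a : Fin 8) :
    ivhsMatrix 4 4 ζ [(1, plane44 0 1 1), (-1, plane44 0 1 3)] (rowPickMinus a) (colPickMinus a) ≠ 0 := by
  rw [entry_eq_parity' ζ h4 (-1) 0 (Or.inr ⟨rfl, rfl⟩)]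
  fin_cases a <;> simp [rowPickMinus, colPickMinus, hz]

/-- LOWER BOUND from a diagonal 8 × 8 minor with nonzero entries. -/
theorem eight_le_rank_of_minor {K : Type*} [Field K] (M : Matrix (indexSet 4 4 (4 / 2 * 4 - 4 - 2)) (indexSet 4 4 4) K)
    (r : Fin 8 → indexSet 4 4 (4 / 2 * 4 - 4 - 2)) (c : Fin 8 → indexSet 4 4 4)
    (hoff : ∀ a b : Fin 8, a ≠ b → M (r a) (c b) = 0) (hdiag : ∀ a, M (r a) (c a) ≠ 0) : 8 ≤ M.rank := by
  classical
  have hS : M.submatrix r c = Matrix.diagonal (fun a => M (r a) (c a)) := by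
    ext a b
    by_cases hab : a = b
    · subst hab
      rw [Matrix.diagonal_apply_eq, Matrix.submatrix_apply]
    · rw [Matrix.diagonal_apply_ne _ hab, Matrix.submatrix_apply]
      exact hoff a b hab
  have hdet : IsUnit (M.submatrix r c).det := by
    rw [hS, Matrix.det_diagonal]
    exact isUnit_iff_ne_zero.mpr (Finset.prod_ne_zero_iff.mpr fun a _ => hdiag a)
  have hrank : (M.submatrix r c).rank = 8 := by
    rw [Matrix.rank_of_isUnit _ ((Matrix.isUnit_iff_isUnit_det _).mpr hdet), Fintype.card_fin]
  calc 8 = (M.submatrix r c).rank := hrank.symm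
    _ ≤ M.rank := Matrix.rank_submatrix_le M r c

/-- PROVED ROW: rank [p_{i+j}([Π₁] + [Π₂])] = 8 (two planes meeting in a line; the degenerate quadric surface, CI(1,1,2) locus of codim 8). -/
theorem ivhsRankEq_linePair_plus : IvhsRankEq 4 4 8 [(1, plane44 0 1 1), (1, plane44 0 1 3)] := by
  intro K _ _ ζ hζ
  have h4 : ζ ^ 4 = -1 := zeta_pow_four_of_primitive hζ
  have hz : ζ ≠ 0 := hζ.ne_zero (by norm_num)
  exact le_antisymm (rank_le_eight ζ h4 1 1 (Or.inl ⟨rfl, rfl⟩))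
    (eight_le_rank_of_minor _ rowPickPlus colPickPlus (minorPlus_offdiag ζ h4) (minorPlus_diag ζ h4 hz))

/-- PROVED ROW: rank [p_{i+j}([Π₁] − [Π₂])] = 8. -/
theorem ivhsRankEq_linePair_minus : IvhsRankEq 4 4 8 [(1, plane44 0 1 1), (-1, plane44 0 1 3)] := by
  intro K _ _ ζ hζ
  have h4 : ζ ^ 4 = -1 := zeta_pow_four_of_primitive hζ
  have hz : ζ ≠ 0 := hζ.ne_zero (by norm_num)
  exact le_antisymm (rank_le_eight ζ h4 (-1) 0 (Or.inr ⟨rfl, rfl⟩))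
    (eight_le_rank_of_minor _ rowPickMinus colPickMinus (minorMinus_offdiag ζ h4) (minorMinus_diag ζ h4 hz))

/-- the census row `explainedSmooth_4_4_1_quadric` of the schema HOLDS. -/
theorem explainedSmooth_4_4_1_quadric_holds : explainedSmooth_4_4_1_quadric := by
  unfold explainedSmooth_4_4_1_quadric ExplainedSmoothRow
  exact ivhsRankEq_linePair_plus

/-- the census row `openInstance_4_4_1_difference` of the schema (its typed part: the RANK) HOLDS. -/
theorem openInstance_4_4_1_difference_holds : openInstance_4_4_1_difference := by
  unfold openInstance_4_4_1_difference
  exact ivhsRankEq_linePair_minus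

/-- the count 8 = 1 + 1 + 1 + 1 + 2 + 2 (modes per type) = codim of the CI(1,1,2) locus = 126 − 118; for the difference the reduced locus
V(Π₁, Π₂) has codim 11 = 8 + 3 (first-order excess 3, R7). -/
theorem eight_modes : 1 + 1 + 1 + 1 + 2 + 2 = 8 ∧ 126 - 118 = 8 ∧ 11 - 8 = 3 := by decide

end Summit.HodgeConjecture.HodgeConjecture.HodgeLocus.Census.LinePair
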